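import Literature.AlgebraicGeometry.HodgeTheory.WeilClassesFieldExceptionalOfCentralSkewElement
import Literature.AlgebraicGeometry.HodgeTheory.WeilClassesFieldQuaternionEndLevel
import Literature.AlgebraicGeometry.HodgeTheory.WeilClassesFieldPolynomialMatricesDecomposable
import Mathlib.LinearAlgebra.Lagrange
import HarnessLib

/-!
# Moonen–Zarhin's `θ` on the carrier as an EIGENVALUE COUNT: the torus `U_E ⊂ G_div(X)` and «type 4, `θ ≠ 0` ⟹ all
# non-zero Weil classes of `F` are exceptional», for every complex abelian variety and its powers (Moonen–Zarhin 1998, §1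
# Criterion (2); Milne 1999, §1)

Layer `Literature/AlgebraicGeometry/HodgeTheory`; THEOREMS ONLY — no definition, no named fact, no `sorry` (D-0026, net
debt 0).  Sequel of the seat's `WeilClassesFieldExceptionalOfCentralTrace` (g13: `θ_ρ(w) = Tr(w | V_ρ) ≠ 0` for
`w = u^* - (u^*)†` ⟹ exceptional, through the Lie algebra of `U_E` — Cayley transforms) and
`WeilClassesFieldExceptionalOfCentralSkewElement` (g14: a central `Q_h`-antisymmetric `u ∈ F`), which it contains and
sharpens: here the torus `U_E(ℂ)` itself is put on the carrier, and the obstruction is read off as a difference of two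
eigenvalue multiplicities — the form in which it can be CHECKED on examples (CM types) and on POWERS.

## The print

B. J. J. Moonen, Yu. G. Zarhin, *Weil classes on abelian varieties*, J. reine angew. Math. **496** (1998) 83–92 =
arXiv:alg-geom/9612017 [MoonenZarhin1998WeilClasses] (held text `paper:arxiv-alg-geom_9612017`), §1, VERBATIM.
Lemma (1) (chunk p0003 L1–L3): «The center of `G_div(X)` is the group `U_{K_B}` given by
`U_{K_B}(R) = {a ∈ (K_B ⊗_ℚ R)^* | a a† = 1}`.  For `X` of type 4 with either `d ≥ 2` or `m ≥ 2` this is a connected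
torus of rank `e₀`; in all other cases it is finite.»  Criterion (2) (chunk p0003 L46–L60): «… or all non-zero classes
in `W_F` are exceptional; this last possibility occurs precisely in the following cases: … `Y` is of Type 4 with `d ≥ 2`
or `m ≥ 2` and the map `θ : E₋ ↪ End_F(V_X) —Tr_F→ F` is non-zero.»  Proof (chunk p0003 L72–L80): «Next assume that
`X` is of type 4 with either `m ≥ 2` or `d ≥ 2`.  We have `F ⊆ B = End⁰(X)`.  Since in this case `G_div(X)` is
connected (see (Gdivprops)), it acts trivially on `W_F` if and only if the composition
`U_E = Z(G_div) ⊂ G_div(X) ↪ Gl_F(V_Y) —det_F→ F^*` is trivial.  The torus `U_E` being connected, this is the case if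
and only if the induced map on Lie algebras `θ : E₋ ↪ End_F(V_X) —Tr_F→ F` is zero.»
J. S. Milne, *Lefschetz classes on abelian varieties*, Duke Math. J. 96 (1999) [Milne1999LefschetzClasses], §1
pp. 642–644 (`C(A)`, `β†`, `S(A)`; «the diagonal action of `C(A)` on `rV(A)` identifies `C(A)` with `C(A^r)`»).

## The carrier dictionary (as in the seat's files)

`V = H¹(A(ℂ); ℂ) = complexBetti A.X 1`; `F = ℚ(φ)`, `P(φ) = 0`, `P ∈ ℤ[T]` monic irreducible of degree `e`, `e · 2m = 2 dim A`,
`V_ρ = ker(φ^* - ρ)` for a complex root `ρ` of `P` (`= V_X ⊗_{F,ρ} ℂ`); `W_F ⊗ ℂ = weilClassesField A φ P (2m)`,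
`𝒟ᵐ ⊗ ℂ = divisorClassesSpan A.X A.dim m`; `h ∈ B¹(A) ⊗ ℂ` with `Q_h` non-degenerate; `C(A) ⊗ ℂ = centralizerAlgebra A`,
`G_div(X)(ℂ)` read as Milne's `S(A)(h)(ℂ) = unitaryCentralizerGroup A h` (as in `WeilClassesFieldDecomposableIffLefschetzGroup`);
`det(u | V_ρ) = detOnEigenspace`.  THE CENTRE: an operator `T ∈ C(A) ⊗ ℂ` — typically the pull-back `ψ^*` of an
endomorphism `ψ` commuting with all of `End(A)` («`ψ ∈ E`») — diagonalisable (killed by a square-free `R`, e.g. the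
minimal polynomial of `ψ` over `ℚ`), whose `Q_h`-adjoint `T'` («`ψ†`», the Rosati image) is a POLYNOMIAL `r(T)` in `T`
(«`†` preserves the subfield `ℚ(ψ)` of the centre» — on the CM centre `E` of a type-4 algebra `†` is complex
conjugation).  The eigenvalues `σ` of `T` are the complex places of `ℚ(ψ)` counted on `V`, and `σ ↦ σ′ = r(σ)` is
complex conjugation read on them.

## What is proved — for EVERY complex abelian variety (no Albert type, no simplicity, no connectedness)

* §0 (private) linear algebra: polynomials in an operator on eigenvectors and on stable subspaces;
  `M = ⊕_{R(z)=0} ker(T - z)` and an eigenbasis WITH MULTIPLICITIES for `T` killed by a square-free `R`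
  (`isInternal_eigenspace_of_aeval_eq_zero`, `exists_eigenbasis_sigma`); eigenspaces and determinant of an operator
  diagonal on a basis (`mem_eigenspace_iff_of_basis`, `det_eq_prod_of_basis`); `ker(T|_W - z) = W ∩ ker(T - z)`.
* §1 THE SPECTRAL INVOLUTION: `ker(T - a) ⊥ ker(T - b)` unless `a = r(b)`, `r(a) = b`
  (`eq_eval_of_polarizationPairingOne_ne_zero`); the spectrum of `T` is `r`-stable and `r` is an involution on it
  (`eigenspace_eval_ne_bot`); **`ker(T' - σ) = ker(T - σ′)`** for spectral `σ` (`eigenspace_adjoint_eq_eigenspace_eval`),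
  `= 0` otherwise.
* §2 **THE TORUS ON THE CARRIER** (`exists_mem_unitaryCentralizerGroup_torus`): for a spectral `σ` with `σ′ ≠ σ` and
  `t ∈ ℂ^×`, the operator `t ⊕ t⁻¹ ⊕ 1` on `ker(T - σ) ⊕ ker(T - σ′) ⊕ (other eigenspaces)` lies in `S(A)(h)(ℂ)` — a
  Lagrange polynomial in `T`, hence in the commutant of `End⁰(A) ⊗ ℂ`, and a `Q_h`-isometry by §1: the `ℂ`-points
  `(t_τ)`, `t_τ̄ = t_τ⁻¹`, of «`U_E = {a | a a† = 1}`».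
* §3 **ITS `F`-LINEAR DETERMINANT** (`detOnEigenspace_eq_prod_pow_finrank`): `det(u | V_ρ) = ∏_z c(z)^{dim(V_ρ ∩ ker(T - z))}`
  for `u` acting by `c(z)` on `ker(T - z)` — «`U_E ↪ Gl_F(V_Y) —det_F→ F^*`» at the place `ρ`.
* §4 **THE THEOREM** (`weilClassesField_inf_divisorClassesSpan_eq_bot_of_finrank_inf_eigenspace_ne`): if for some root
  `ρ` of `P` and some `σ` the multiplicities `dim(V_ρ ∩ ker(T - σ))` and `dim(V_ρ ∩ ker(T' - σ))` DIFFER, then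
  `W_F ⊗ ℂ ⊓ 𝒟ᵐ ⊗ ℂ = ⊥` (`m ≠ 0`): ALL NON-ZERO WEIL CLASSES OF `F` ARE EXCEPTIONAL (the torus element `2 ⊕ 2⁻¹ ⊕ 1` has
  `det = 2^{dim(V_ρ ∩ ker(T-σ)) - dim(V_ρ ∩ ker(T-σ′))} ≠ 1`, and the tree's
  `weilClassesField_inf_divisorClassesSpan_eq_bot_iff_exists_detOnEigenspace_ne_one`); set form
  `not_mem_divisorClassesSpan_…`; with Criterion (1) «Hodge but exceptional» `…_le_hodgeClassSpan_and_inf_eq_bot_…`.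
  RELATION TO THE PRINT: for `α = ψ - ψ† ∈ E₋`, `θ(α)` at the place `ρ` is `Σ_σ (dim(V_ρ ∩ ker(ψ^* - σ)) -
  dim(V_ρ ∩ ker(ψ†^* - σ))) · σ`; the displayed imbalance is what makes «`U_E → F^*` non-trivial», with no appeal to
  the Lie algebra or to linear independence of characters.  It contains g14's `…_of_central_skew` (`T' = -T`, where
  `ker(T' - σ) = ker(T + σ)` and `T = p(φ^*)` is a non-zero scalar on some `V_ρ`).
* §5 `End(A)`-level wrappers (`…_of_central_of_finrank_ne`): `T = ψ^*`, `ψ^* ∈ C(A) ⊗ ℂ`, `R(ψ) = 0` with `R ∈ ℤ[T]`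
  irreducible over `ℚ`, `T' = ψ'^*` for a `ψ' ∈ End(A)` with `ψ'^* ∈ ℂ[ψ^*]` and `Q_h(ψ^* x, y) = Q_h(x, ψ'^* y)`.
* §6 **POWERS** (`weilClassesField_biproduct_inf_divisorClassesSpan_eq_bot_of_central_of_finrank_ne`): on `X = A^{n+1}`
  with the product polarization `Σ πᵢ^* h` (Milne's slotwise involution, the seat's
  `polarizationPairingOne_biproductMap_of_adjoint`), the diagonal `⊕ψ` of a central `ψ` is central in
  `End(X) = M_{n+1}(End A)` (`biproductMap_const_comm_of_forall_comm`, `pullbackOne_biproductMap_const_mem_centralizerAlgebra`),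
  `(⊕ψ')^* ∈ ℂ[(⊕ψ)^*]`, `R((⊕ψ)^*) = 0`; so the theorem applies to every `F = ℚ(φ) ⊆ End⁰(A^{n+1})` with the
  multiplicities counted on `H¹(A^{n+1})` — the print's «`X ∼ Y^m`, `m ≥ 2`» for the type-4 direction `θ ≠ 0 ⟹ exceptional`.

Scope (honest column).  The converse «`θ = 0` ⟹ `W_F` decomposable» for type 4 with `d ≥ 2` or `m ≥ 2` is NOT here (it
needs `G_div(X)` connected and generated by its centre and commutators — algebraic-group structure absent on the
carrier); neither are Table 1, the identification `K_B = E`, nor the rank of `U_E`.  `ψ'` integral with `ψ'^* = (ψ^*)†`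
exactly; a Rosati image with denominators is covered by the operator-level §4 (`T' = N⁻¹ · ψ''^*`).

## References

* [MoonenZarhin1998WeilClasses] B. J. J. Moonen, Yu. G. Zarhin, Weil classes on abelian varieties, J. reine angew.
  Math. 496 (1998) 83–92; arXiv:alg-geom/9612017: §1 Lemma (1)–(2) (chunk p0003 L1–L45), Criterion (2) and its proof
  (chunk p0003 L46–L90), Remark (2) (chunk p0004 L48–L53).
* [Milne1999LefschetzClasses] J. S. Milne, Lefschetz classes on abelian varieties, Duke Math. J. 96 (1999) 639–675,
  §1 pp. 642–644, Thm. 3.2, Thm. 4.4, Cor. 4.5.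
* [LangeBirkenhake1992] H. Lange, Ch. Birkenhake, Complex Abelian Varieties, Grundlehren 302 (1992), §1.1 (rational
  representation), §5.1 (Rosati involution = adjoint), §5.3 (products).
* [vanGeemen1994HodgeAV] B. van Geemen, An introduction to the Hodge conjecture for abelian varieties, LNM 1594 (1994),
  6.9–6.12 (`det` on the eigenspaces `W`, `W̄`).
* [HornJohnson2013] R. A. Horn, C. R. Johnson, Matrix Analysis, 2nd ed. (CUP 2013), §1.1, §1.3 (Lagrange interpolation,
  functions of a diagonalisable operator).

## Provenance

Lane `lit-hodgefound` (Track 2, Layer A), prover seat `lit-hodgefound-p21` (generation 22), row g22-#1; successor note (b)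
of generation 21 («the EXCEPTIONAL side of Criterion (2) on powers»), type-4 part.
-/

noncomputable section

open CategoryTheory CategoryTheory.Limits Polynomial Module
open Literature.AlgebraicTopology.SingularHomology
open Literature.AlgebraicGeometry.Motives
open Literature.AlgebraicGeometry.VanGeemen1994 (hodgeClassSpan pullbackOne detOnEigenspace mapsTo_eigenspace_of_comm)
open Literature.AlgebraicGeometry.Milne1999
open Literature.Barriers.HodgeConjecture (divisorClassesSpan)
open Literature.Geometry.Kaehler (lefschetzPow)

namespace Literature.AlgebraicGeometry.HodgeTheory

namespace CentralTorus

/-! ### §0 Linear algebra (private): polynomials in a diagonalisable operator -/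

section LinAlg

variable {M : Type*} [AddCommGroup M] [Module ℂ M]

/-- `q(T) x = q(μ) x` on the eigenspace `ker(T - μ)`. [folklore] -/
private theorem aeval_apply_of_mem_eigenspace {T : Module.End ℂ M} {μ : ℂ} {x : M} (hx : x ∈ T.eigenspace μ)
    (q : ℂ[X]) : aeval T q x = q.eval μ • x := by
  by_cases hx0 : x = 0
  · rw [hx0, map_zero, smul_zero]
  · exact Module.End.aeval_apply_of_hasEigenvector (Module.End.hasEigenvector_iff.2 ⟨hx, hx0⟩)

/-- A linear map intertwining `f` and `g` intertwines `q(f)` and `q(g)`. [folklore] -/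
private theorem map_aeval_apply_of_semiconj {N : Type*} [AddCommGroup N] [Module ℂ N] (L : M →ₗ[ℂ] N)
    (f : Module.End ℂ M) (g : Module.End ℂ N) (hc : ∀ v, L (f v) = g (L v)) (q : ℂ[X]) (v : M) :
    L (aeval f q v) = aeval g q (L v) := by
  induction q using Polynomial.induction_on' generalizing v with
  | add p q hp hq => rw [map_add, map_add, LinearMap.add_apply, LinearMap.add_apply, map_add, hp, hq]
  | monomial k c =>
    rw [aeval_monomial, aeval_monomial, Module.End.mul_apply, Module.End.mul_apply,
      Module.algebraMap_end_apply, Module.algebraMap_end_apply, map_smul]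
    congr 1
    induction k generalizing v with
    | zero => rfl
    | succ k ih => rw [pow_succ, pow_succ, Module.End.mul_apply, Module.End.mul_apply, ih, hc]

/-- The restriction of `q(T)` to a `T`-stable subspace is `q(T|_W)`. [folklore] -/
private theorem coe_aeval_restrict {T : Module.End ℂ M} {W : Submodule ℂ M} (hW : ∀ x ∈ W, T x ∈ W) (q : ℂ[X]) (x : W) :
    ((aeval (T.restrict hW) q) x : M) = aeval T q (x : M) :=
  map_aeval_apply_of_semiconj W.subtype (T.restrict hW) T (fun _ ↦ rfl) q x

/-- An operator commuting with `T` commutes with every `q(T)`. [folklore] -/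
private theorem aeval_mul_eq_mul_aeval_of_comm {T S : Module.End ℂ M} (hc : S * T = T * S) (q : ℂ[X]) :
    aeval T q * S = S * aeval T q := by
  have hS : S ∈ Subalgebra.centralizer ℂ ({T} : Set (Module.End ℂ M)) := by
    rw [Subalgebra.mem_centralizer_iff]
    rintro _ rfl
    exact hc.symm
  have hq := Algebra.adjoin_le_centralizer_centralizer ℂ ({T} : Set (Module.End ℂ M))
    (Polynomial.aeval_mem_adjoin_singleton ℂ T (p := q))
  rw [Subalgebra.mem_centralizer_iff] at hq
  exact (hq S hS).symm

/-- The eigenvalues of an operator killed by `R ≠ 0` are roots of `R`. [folklore] -/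
private theorem isRoot_of_eigenspace_ne_bot {T : Module.End ℂ M} {R : ℂ[X]} (hTR : aeval T R = 0) {μ : ℂ}
    (hμ : T.eigenspace μ ≠ ⊥) : R.IsRoot μ := by
  obtain ⟨v, hv, hv0⟩ := (Submodule.ne_bot_iff _).1 hμ
  have h := Module.End.aeval_apply_of_hasEigenvector (f := T) (p := R) (Module.End.hasEigenvector_iff.2 ⟨hv, hv0⟩)
  rw [hTR, LinearMap.zero_apply] at h
  exact (smul_eq_zero.1 h.symm).resolve_right hv0

/-- **The eigenspaces of a diagonal operator**: if `S` acts on a basis `b` by `S bᵢ = eᵢ bᵢ`, then `x ∈ ker(S - μ)` iff every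
coordinate `xᵢ ≠ 0` has `eᵢ = μ`. [folklore] -/
private theorem mem_eigenspace_iff_of_basis {ι : Type*} [Fintype ι] (b : Module.Basis ι ℂ M) {S : Module.End ℂ M} {e : ι → ℂ}
    (hS : ∀ i, S (b i) = e i • b i) {μ : ℂ} {x : M} :
    x ∈ S.eigenspace μ ↔ ∀ i, b.repr x i ≠ 0 → e i = μ := by
  classical
  have hSx : ∀ i, b.repr (S x) i = e i * b.repr x i := by
    intro i
    conv_lhs => rw [← b.sum_repr x]
    rw [map_sum]
    simp_rw [map_smul, hS, smul_smul, map_sum, map_smul, b.repr_self, Finsupp.smul_single, smul_eq_mul, mul_one,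
      Finset.sum_apply', Finsupp.single_apply]
    rw [Finset.sum_eq_single i (fun j _ hj ↦ if_neg hj) (fun hi ↦ absurd (Finset.mem_univ i) hi), if_pos rfl, mul_comm]
  rw [Module.End.mem_eigenspace_iff]
  constructor
  · intro h i hi
    have := congrArg (fun y ↦ b.repr y i) h
    simp only [hSx, map_smul, Finsupp.smul_apply, smul_eq_mul] at this
    exact mul_right_cancel₀ hi this
  · intro h
    refine b.repr.injective (Finsupp.ext fun i ↦ ?_)
    rw [hSx, map_smul, Finsupp.smul_apply, smul_eq_mul]
    by_cases hi : b.repr x i = 0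
    · rw [hi, mul_zero, mul_zero]
    · rw [h i hi]

/-- The determinant of a diagonal operator is the product of its diagonal entries. [folklore] -/
private theorem det_eq_prod_of_basis {ι : Type*} [Fintype ι] [DecidableEq ι] (b : Module.Basis ι ℂ M) {S : Module.End ℂ M}
    {e : ι → ℂ} (hS : ∀ i, S (b i) = e i • b i) : LinearMap.det S = ∏ i, e i := by
  have hmat : LinearMap.toMatrix b b S = Matrix.diagonal e := by
    ext i j
    rw [LinearMap.toMatrix_apply, hS, map_smul, b.repr_self, Finsupp.smul_single, smul_eq_mul, mul_one,
      Matrix.diagonal_apply, Finsupp.single_apply]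
    by_cases h : i = j
    · subst h; simp
    · rw [if_neg h, if_neg (Ne.symm h)]
  rw [← LinearMap.det_toMatrix b, hmat, Matrix.det_diagonal]

/-- The eigenspace of a restriction `T|_W` at `z`, read in the ambient space, is `W ∩ ker(T - z)`. [folklore] -/
private theorem map_subtype_eigenspace_restrict {T : Module.End ℂ M} {W : Submodule ℂ M} (hW : ∀ x ∈ W, T x ∈ W) (z : ℂ) :
    (Module.End.eigenspace (T.restrict hW) z).map W.subtype = W ⊓ T.eigenspace z := by
  ext x
  simp only [Submodule.mem_map, Submodule.mem_inf, Module.End.mem_eigenspace_iff]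
  constructor
  · rintro ⟨y, hy, rfl⟩
    refine ⟨y.2, ?_⟩
    have e := congrArg Subtype.val hy
    rwa [LinearMap.coe_restrict_apply, Submodule.coe_smul] at e
  · rintro ⟨hxW, hx⟩
    exact ⟨⟨x, hxW⟩, Subtype.ext (by rw [LinearMap.coe_restrict_apply, Submodule.coe_smul]; exact hx), rfl⟩

variable [FiniteDimensional ℂ M]

/-- **`M = ⊕_{R(z) = 0} ker(T - z)`** for an operator `T` killed by a square-free polynomial `R ≠ 0` over `ℂ`
(`T` is semisimple, its eigenspaces are independent and span). [folklore] -/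
private theorem isInternal_eigenspace_of_aeval_eq_zero {T : Module.End ℂ M} {R : ℂ[X]} (hR0 : R ≠ 0) (hRsq : Squarefree R)
    (hTR : aeval T R = 0) :
    DirectSum.IsInternal fun z : R.roots.toFinset ↦ T.eigenspace (z : ℂ) := by
  classical
  have hss : T.IsSemisimple := Module.End.isSemisimple_of_squarefree_aeval_eq_zero hRsq hTR
  have htop : ⨆ μ, T.eigenspace μ = ⊤ := hss.iSup_eigenspace_eq_top
  have hind : iSupIndep fun z : R.roots.toFinset ↦ T.eigenspace (z : ℂ) :=
    (Module.End.eigenspaces_iSupIndep T).comp Subtype.val_injective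
  have hsup : (⨆ z : R.roots.toFinset, T.eigenspace (z : ℂ)) = ⊤ := by
    refine le_antisymm le_top ?_
    rw [← htop]
    refine iSup_le fun μ ↦ ?_
    by_cases hμ : T.eigenspace μ = ⊥
    · rw [hμ]; exact bot_le
    · exact le_iSup (fun z : R.roots.toFinset ↦ T.eigenspace (z : ℂ))
        ⟨μ, Multiset.mem_toFinset.2 ((Polynomial.mem_roots hR0).2 (isRoot_of_eigenspace_ne_bot hTR hμ))⟩
  exact DirectSum.isInternal_submodule_of_iSupIndep_of_iSup_eq_top hind hsup

/-- **An eigenbasis with multiplicities**: for `T` killed by a square-free `R`, a basis of `M` indexed by the pairs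
`(z, k)`, `z` a root of `R`, `k < dim ker(T - z)`, whose `(z, k)`-th vector lies in `ker(T - z)`. [folklore] -/
private theorem exists_eigenbasis_sigma {T : Module.End ℂ M} {R : ℂ[X]} (hRsq : Squarefree R) (hTR : aeval T R = 0) :
    ∃ (b : Module.Basis (Σ z : R.roots.toFinset, Fin (Module.finrank ℂ ↥(T.eigenspace (z : ℂ)))) ℂ M)
      (ev : (Σ z : R.roots.toFinset, Fin (Module.finrank ℂ ↥(T.eigenspace (z : ℂ)))) → ℂ),
      (∀ j, ev j = (j.1 : ℂ)) ∧ ∀ j, b j ∈ T.eigenspace (ev j) := by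
  classical
  have hint := isInternal_eigenspace_of_aeval_eq_zero hRsq.ne_zero hRsq hTR
  exact ⟨hint.collectedBasis fun z ↦ Module.finBasis ℂ ↥(T.eigenspace (z : ℂ)), fun j ↦ (j.1 : ℂ), fun _ ↦ rfl,
    fun j ↦ hint.collectedBasis_mem _ j⟩

end LinAlg

/-! ### §1 The spectral involution `σ ↦ σ′` of a central operator with a polynomial Rosati adjoint -/

section Spectral

variable {A : AbelianVariety ℂ} {h : complexBetti A.X 2} {T T' : Module.End ℂ (complexBetti A.X 1)} {r R : ℂ[X]}

/-- **Orthogonality of eigenspaces.** If `T' = r(T)` is the `Q_h`-adjoint of `T` (`Q_h(Tx, y) = Q_h(x, T'y)`), then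
`ker(T - a)` and `ker(T - b)` are `Q_h`-orthogonal unless `a = r(b)` and `r(a) = b`: on `x ∈ ker(T - a)`, `y ∈ ker(T - b)`,
`a·Q_h(x, y) = Q_h(Tx, y) = Q_h(x, T'y) = r(b)·Q_h(x, y)` and `b·Q_h(x, y) = Q_h(x, Ty) = Q_h(T'x, y) = r(a)·Q_h(x, y)` — the
complexification of «the Rosati involution induces complex conjugation on the CM centre `E`», place by place.
[cite: MoonenZarhin1998WeilClasses, §1 Lemma (1) and proof of Criterion (2) (the torus U_E = {a ∈ E ⊗ R | a a† = 1}; chunk p0003 L1–L3, L72–L80)]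
[cite: Milne1999LefschetzClasses, §1 p. 642 (the adjoint β†)] -/
theorem eq_eval_of_polarizationPairingOne_ne_zero
    (hadj : ∀ x y : complexBetti A.X 1, polarizationPairingOne A.X h (A.dim - 1) (T x) y =
      polarizationPairingOne A.X h (A.dim - 1) x (T' y))
    (hr : T' = aeval T r) {a b : ℂ} {x y : complexBetti A.X 1} (hx : x ∈ T.eigenspace a) (hy : y ∈ T.eigenspace b)
    (hQ : polarizationPairingOne A.X h (A.dim - 1) x y ≠ 0) : a = r.eval b ∧ r.eval a = b := by
  have hTx : T x = a • x := Module.End.mem_eigenspace_iff.1 hx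
  have hTy : T y = b • y := Module.End.mem_eigenspace_iff.1 hy
  have hT'x : T' x = r.eval a • x := by rw [hr]; exact aeval_apply_of_mem_eigenspace hx r
  have hT'y : T' y = r.eval b • y := by rw [hr]; exact aeval_apply_of_mem_eigenspace hy r
  have e1 := hadj x y
  rw [hTx, hT'y, LinearMap.map_smul₂, map_smul] at e1
  have e2 : polarizationPairingOne A.X h (A.dim - 1) x (T y) = polarizationPairingOne A.X h (A.dim - 1) (T' x) y := by
    rw [← neg_inj, ← polarizationPairingOne_swap, hadj, polarizationPairingOne_swap]
  rw [hTy, hT'x, map_smul, LinearMap.map_smul₂] at e2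
  exact ⟨smul_left_injective ℂ hQ e1, (smul_left_injective ℂ hQ e2).symm⟩

/-- **Non-degeneracy meets the eigenspace decomposition**: for `T` diagonalisable (killed by a square-free `R`) and `Q_h`
non-degenerate, every non-zero `x` pairs non-trivially with some eigenvector of `T` (`V = ⊕_σ V_σ` and «when `D` is
ample, `e_D` is nondegenerate»). [cite: Milne1999LefschetzClasses, §1 p. 642] [cite: MoonenZarhin1998WeilClasses, §1 (V_ℂ = ⊕_σ V_{ℂ,σ}; chunk p0001 L44–L50)] -/
theorem exists_mem_eigenspace_polarizationPairingOne_ne_zero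
    (hnd : ∀ x : complexBetti A.X 1, (∀ y, polarizationPairingOne A.X h (A.dim - 1) x y = 0) → x = 0)
    (hRsq : Squarefree R) (hTR : aeval T R = 0) {x : complexBetti A.X 1} (hx0 : x ≠ 0) :
    ∃ (b : ℂ) (y : complexBetti A.X 1), y ∈ T.eigenspace b ∧ polarizationPairingOne A.X h (A.dim - 1) x y ≠ 0 := by
  haveI : Module.Finite ℂ (complexBetti A.X 1) := abelianVarietyCohomologyExteriorH1_holds.finite_one A
  by_contra hcon
  push Not at hcon
  have htop : ⨆ μ, T.eigenspace μ = ⊤ :=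
    (Module.End.isSemisimple_of_squarefree_aeval_eq_zero hRsq hTR).iSup_eigenspace_eq_top
  refine hx0 (hnd x fun y ↦ ?_)
  have hy : y ∈ ⨆ μ, T.eigenspace μ := by rw [htop]; exact Submodule.mem_top
  induction hy using Submodule.iSup_induction' with
  | mem μ y hy => exact hcon μ y hy
  | zero => exact map_zero _
  | add y y' _ _ hy hy' => rw [map_add, hy, hy', add_zero]

/-- **The spectrum of a central `T` with polynomial adjoint `T' = r(T)` is stable under `σ ↦ σ′ = r(σ)`, an INVOLUTION
on it**: if `ker(T - a) ≠ 0` then `ker(T - r(a)) ≠ 0` and `r(r(a)) = a` (a non-zero `x ∈ ker(T - a)` pairs with an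
eigenvector `y ∈ ker(T - b)`, forcing `a = r(b)`, `r(a) = b`). For the CM centre `E` of `End⁰(X)` this is complex
conjugation on the embeddings `Σ_E`. [cite: MoonenZarhin1998WeilClasses, §1 (E, E₀ and the torus U_E; chunk p0002 L44–L50, chunk p0003 L1–L3)] -/
theorem eigenspace_eval_ne_bot
    (hnd : ∀ x : complexBetti A.X 1, (∀ y, polarizationPairingOne A.X h (A.dim - 1) x y = 0) → x = 0)
    (hRsq : Squarefree R) (hTR : aeval T R = 0)
    (hadj : ∀ x y : complexBetti A.X 1, polarizationPairingOne A.X h (A.dim - 1) (T x) y =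
      polarizationPairingOne A.X h (A.dim - 1) x (T' y))
    (hr : T' = aeval T r) {a : ℂ} (ha : T.eigenspace a ≠ ⊥) :
    T.eigenspace (r.eval a) ≠ ⊥ ∧ r.eval (r.eval a) = a := by
  obtain ⟨x, hx, hx0⟩ := (Submodule.ne_bot_iff _).1 ha
  obtain ⟨b, y, hy, hQ⟩ := exists_mem_eigenspace_polarizationPairingOne_ne_zero hnd hRsq hTR hx0
  obtain ⟨h1, h2⟩ := eq_eval_of_polarizationPairingOne_ne_zero hadj hr hx hy hQ
  have hy0 : y ≠ 0 := fun h0 ↦ hQ (by rw [h0, map_zero])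
  rw [h2, h1]
  exact ⟨(Submodule.ne_bot_iff _).2 ⟨y, hy, hy0⟩, rfl⟩

/-- **The eigenspaces of the adjoint**: for `σ` in the spectrum of `T`, `ker(T' - σ) = ker(T - σ′)`, `σ′ = r(σ)` (both
operators are diagonal on an eigenbasis of `T`, with eigenvalues `z` and `r(z)`, and `r` is an involution of the spectrum).
[cite: MoonenZarhin1998WeilClasses, §1 (E₋ and the torus U_E; chunk p0003 L1–L3, L72–L80)] -/
theorem eigenspace_adjoint_eq_eigenspace_eval
    (hnd : ∀ x : complexBetti A.X 1, (∀ y, polarizationPairingOne A.X h (A.dim - 1) x y = 0) → x = 0)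
    (hRsq : Squarefree R) (hTR : aeval T R = 0)
    (hadj : ∀ x y : complexBetti A.X 1, polarizationPairingOne A.X h (A.dim - 1) (T x) y =
      polarizationPairingOne A.X h (A.dim - 1) x (T' y))
    (hr : T' = aeval T r) {σ : ℂ} (hσ : T.eigenspace σ ≠ ⊥) :
    T'.eigenspace σ = T.eigenspace (r.eval σ) := by
  classical
  haveI : Module.Finite ℂ (complexBetti A.X 1) := abelianVarietyCohomologyExteriorH1_holds.finite_one A
  obtain ⟨b, ev, -, hb⟩ := exists_eigenbasis_sigma hRsq hTR
  have hTb : ∀ j, T (b j) = ev j • b j := fun j ↦ Module.End.mem_eigenspace_iff.1 (hb j)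
  have hT'b : ∀ j, T' (b j) = r.eval (ev j) • b j := fun j ↦ by rw [hr]; exact aeval_apply_of_mem_eigenspace (hb j) r
  have hspec : ∀ j, T.eigenspace (ev j) ≠ ⊥ := fun j ↦ (Submodule.ne_bot_iff _).2 ⟨b j, hb j, b.ne_zero j⟩
  have hrr := (eigenspace_eval_ne_bot hnd hRsq hTR hadj hr hσ).2
  ext x
  rw [mem_eigenspace_iff_of_basis b hT'b, mem_eigenspace_iff_of_basis b hTb]
  refine forall_congr' fun j ↦ imp_congr_right fun _ ↦ ⟨fun hj ↦ ?_, fun hj ↦ ?_⟩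
  · rw [← hj]
    exact ((eigenspace_eval_ne_bot hnd hRsq hTR hadj hr (hspec j)).2).symm
  · rw [hj, hrr]

/-- … and `ker(T' - σ) = 0` when `σ` is not in the spectrum of `T` (a coordinate of an eigenvector of `T'` for `σ` would
exhibit `σ = r(z)` for a spectral `z`, and the spectrum is `r`-stable): `ψ` and `ψ†` have the same places.
[cite: MoonenZarhin1998WeilClasses, §1 (E₋ and the torus U_E; chunk p0003 L1–L3, L72–L80)] -/
theorem eigenspace_adjoint_eq_bot
    (hnd : ∀ x : complexBetti A.X 1, (∀ y, polarizationPairingOne A.X h (A.dim - 1) x y = 0) → x = 0)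
    (hRsq : Squarefree R) (hTR : aeval T R = 0)
    (hadj : ∀ x y : complexBetti A.X 1, polarizationPairingOne A.X h (A.dim - 1) (T x) y =
      polarizationPairingOne A.X h (A.dim - 1) x (T' y))
    (hr : T' = aeval T r) {σ : ℂ} (hσ : T.eigenspace σ = ⊥) : T'.eigenspace σ = ⊥ := by
  classical
  haveI : Module.Finite ℂ (complexBetti A.X 1) := abelianVarietyCohomologyExteriorH1_holds.finite_one A
  obtain ⟨b, ev, -, hb⟩ := exists_eigenbasis_sigma hRsq hTR
  have hT'b : ∀ j, T' (b j) = r.eval (ev j) • b j := fun j ↦ by rw [hr]; exact aeval_apply_of_mem_eigenspace (hb j) r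
  have hspec : ∀ j, T.eigenspace (ev j) ≠ ⊥ := fun j ↦ (Submodule.ne_bot_iff _).2 ⟨b j, hb j, b.ne_zero j⟩
  rw [Submodule.eq_bot_iff]
  intro x hx
  rw [mem_eigenspace_iff_of_basis b hT'b] at hx
  by_contra hx0
  obtain ⟨j, hj⟩ : ∃ j, b.repr x j ≠ 0 := by
    by_contra hall
    push Not at hall
    exact hx0 (b.repr.injective (Finsupp.ext fun j ↦ by rw [hall j, map_zero, Finsupp.zero_apply]))
  have h1 := hx j hj
  rw [← h1] at hσ
  exact (eigenspace_eval_ne_bot hnd hRsq hTR hadj hr (hspec j)).1 hσ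

end Spectral

/-! ### §2 The torus `U_E(ℂ)` on the carrier: the elements `t ⊕ t⁻¹ ⊕ 1` of `S(A)(h)(ℂ)` -/

section Torus

variable {A : AbelianVariety ℂ} {h : complexBetti A.X 2} {T T' : Module.End ℂ (complexBetti A.X 1)} {r R : ℂ[X]}

/-- **THE TORUS `U_E` ACTS ON THE CARRIER INSIDE `G_div(X)(ℂ)`.** Let `T ∈ C(A) ⊗ ℂ` (an operator on `H¹(A(ℂ); ℂ)`
commuting with every `φ^*`, `φ ∈ End(A)` — e.g. the pull-back of a CENTRAL endomorphism), diagonalisable (killed by a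
square-free `R`), whose `Q_h`-adjoint is a polynomial `T' = r(T)` (`Q_h` non-degenerate), and let `σ` be an eigenvalue
of `T` with `σ′ = r(σ) ≠ σ` (a «complex place»). Then for every `t ∈ ℂ^×` the operator `u_t` acting by `t` on
`ker(T - σ)`, by `t⁻¹` on `ker(T - σ′)` and by `1` on the other eigenspaces of `T` lies in
`S(A)(h)(ℂ) = unitaryCentralizerGroup A h`: it is a polynomial in `T` (Lagrange), hence commutes with `End⁰(A) ⊗ ℂ`, and
it preserves `Q_h` because `ker(T - a) ⊥ ker(T - b)` unless `b = a′` (§1). These are the `ℂ`-points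
`(t_τ)_τ`, `t_{τ̄} = t_τ⁻¹`, of Moonen–Zarhin's torus `U_E = {a ∈ (E ⊗ R)^* | a a† = 1} = Z(G_div)`.
[cite: MoonenZarhin1998WeilClasses, §1 Lemma (1) («the center of G_div(X) is the group U_{K_B}»; chunk p0003 L1–L3) and proof of Criterion (2) (chunk p0003 L72–L80)]
[cite: Milne1999LefschetzClasses, §1 p. 644 (S(A))] -/
theorem exists_mem_unitaryCentralizerGroup_torus
    (hnd : ∀ x : complexBetti A.X 1, (∀ y, polarizationPairingOne A.X h (A.dim - 1) x y = 0) → x = 0)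
    (hTC : T ∈ centralizerAlgebra A) (hRsq : Squarefree R) (hTR : aeval T R = 0)
    (hadj : ∀ x y : complexBetti A.X 1, polarizationPairingOne A.X h (A.dim - 1) (T x) y =
      polarizationPairingOne A.X h (A.dim - 1) x (T' y))
    (hr : T' = aeval T r) {σ : ℂ} (hσ : T.eigenspace σ ≠ ⊥) (hσ' : r.eval σ ≠ σ) {t : ℂ} (ht : t ≠ 0) :
    ∃ u : complexBetti A.X 1 ≃ₗ[ℂ] complexBetti A.X 1, u ∈ unitaryCentralizerGroup A h ∧
      ∀ (z : ℂ), ∀ x ∈ T.eigenspace z, u x = (if z = σ then t else if z = r.eval σ then t⁻¹ else 1) • x := by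
  classical
  haveI : Module.Finite ℂ (complexBetti A.X 1) := abelianVarietyCohomologyExteriorH1_holds.finite_one A
  set Z : Finset ℂ := R.roots.toFinset with hZdef
  set c : ℂ → ℂ := fun z ↦ if z = σ then t else if z = r.eval σ then t⁻¹ else 1 with hcdef
  have hc0 : ∀ z, c z ≠ 0 := by
    intro z
    simp only [hcdef]
    split_ifs
    exacts [ht, inv_ne_zero ht, one_ne_zero]
  have hmemZ : ∀ {z : ℂ} {x : complexBetti A.X 1}, x ∈ T.eigenspace z → x ≠ 0 → z ∈ Z := fun {z x} hx hx0 ↦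
    Multiset.mem_toFinset.2 ((Polynomial.mem_roots hRsq.ne_zero).2
      (isRoot_of_eigenspace_ne_bot hTR ((Submodule.ne_bot_iff _).2 ⟨x, hx, hx0⟩)))
  -- the Lagrange interpolants of `c` and `c⁻¹` on the spectrum
  set p : ℂ[X] := Lagrange.interpolate Z id c with hpdef
  set p' : ℂ[X] := Lagrange.interpolate Z id (fun z ↦ (c z)⁻¹) with hp'def
  have hp : ∀ z ∈ Z, p.eval z = c z := fun z hz ↦ Lagrange.eval_interpolate_at_node c (Set.injOn_id _) hz
  have hp' : ∀ z ∈ Z, p'.eval z = (c z)⁻¹ := fun z hz ↦ Lagrange.eval_interpolate_at_node _ (Set.injOn_id _) hz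
  set uL : Module.End ℂ (complexBetti A.X 1) := aeval T p with huLdef
  set uL' : Module.End ℂ (complexBetti A.X 1) := aeval T p' with huL'def
  have huL : ∀ (z : ℂ), ∀ x ∈ T.eigenspace z, uL x = c z • x := by
    intro z x hx
    by_cases hx0 : x = 0
    · rw [hx0, map_zero, smul_zero]
    · rw [huLdef, aeval_apply_of_mem_eigenspace hx, hp z (hmemZ hx hx0)]
  have huL' : ∀ (z : ℂ), ∀ x ∈ T.eigenspace z, uL' x = (c z)⁻¹ • x := by
    intro z x hx
    by_cases hx0 : x = 0
    · rw [hx0, map_zero, smul_zero]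
    · rw [huL'def, aeval_apply_of_mem_eigenspace hx, hp' z (hmemZ hx hx0)]
  obtain ⟨b, ev, -, hb⟩ := exists_eigenbasis_sigma hRsq hTR
  have h1 : uL * uL' = 1 := b.ext fun j ↦ by
    rw [Module.End.mul_apply, huL' _ _ (hb j), map_smul, huL _ _ (hb j), smul_smul, inv_mul_cancel₀ (hc0 _), one_smul,
      Module.End.one_apply]
  have h2 : uL' * uL = 1 := b.ext fun j ↦ by
    rw [Module.End.mul_apply, huL _ _ (hb j), map_smul, huL' _ _ (hb j), smul_smul, mul_inv_cancel₀ (hc0 _), one_smul,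
      Module.End.one_apply]
  let u : complexBetti A.X 1 ≃ₗ[ℂ] complexBetti A.X 1 :=
    LinearEquiv.ofLinear uL uL' (by rw [← Module.End.mul_eq_comp, h1]; rfl) (by rw [← Module.End.mul_eq_comp, h2]; rfl)
  have hu : ∀ x, u x = uL x := fun _ ↦ rfl
  refine ⟨u, ⟨fun χ x ↦ ?_, fun x y ↦ ?_⟩, fun z x hx ↦ by rw [hu]; exact huL z x hx⟩
  · -- `u` is a polynomial in `T ∈ C(A) ⊗ ℂ`, hence commutes with every pull-back
    rw [hu, hu]
    have hcomm := aeval_mul_eq_mul_aeval_of_comm (mem_centralizerAlgebra_iff.1 hTC χ) p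
    have e := LinearMap.congr_fun hcomm x
    rw [Module.End.mul_apply, Module.End.mul_apply] at e
    rw [huLdef]
    exact e
  · -- `u` preserves `Q_h`: on the eigenbasis, `c(a) c(b) = 1` whenever `ker(T - a)`, `ker(T - b)` pair non-trivially
    rw [hu, hu]
    have hrr := (eigenspace_eval_ne_bot hnd hRsq hTR hadj hr hσ).2
    refine polarizationPairingOne_apply_apply_eq_of_basis b (u := uL) (d := fun j ↦ c (ev j))
      (fun j ↦ huL _ _ (hb j)) (fun i j hij ↦ ?_) x y
    obtain ⟨hi, hj⟩ := eq_eval_of_polarizationPairingOne_ne_zero hadj hr (hb i) (hb j) hij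
    by_cases hi1 : ev i = σ
    · have hj1 : ev j = r.eval σ := by rw [← hj, hi1]
      simp only [hcdef, hi1, if_true, hj1, if_neg hσ', mul_inv_cancel₀ ht]
    · by_cases hi2 : ev i = r.eval σ
      · have hj1 : ev j = σ := by rw [← hj, hi2, hrr]
        simp only [hcdef, hi2, if_neg hσ', if_true, hj1, inv_mul_cancel₀ ht]
      · have hj1 : ev j ≠ σ := fun e ↦ hi2 (by rw [hi, e])
        have hj2 : ev j ≠ r.eval σ := fun e ↦ hi1 (by rw [hi, e, hrr])
        simp only [hcdef, if_neg hi1, if_neg hi2, if_neg hj1, if_neg hj2, mul_one]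

/-! ### §3 The `F`-linear determinant of a torus element on `V_ρ`, through eigenvalue multiplicities -/

/-- **`det(u | V_ρ) = ∏_z c(z)^{dim(V_ρ ∩ ker(T - z))}`** for an automorphism `u` acting on each eigenspace `ker(T - z)` of a
diagonalisable `T` (killed by a square-free `R`) by the scalar `c(z)`, and an operator `F` commuting with `T` and `u`
(`V_ρ = ker(F - ρ)` is `T`-stable and `T|_{V_ρ}` is diagonalisable with the multiplicities displayed). This is the
complexification at one place `ρ` of `F` of Moonen–Zarhin's «the action … on `W_F` is given by the `F`-linear determinant»
for the torus: `det_F(u; V_X)_ρ = ∏_τ t_τ^{dim_ℂ (V_X ⊗_{F,ρ} ℂ)_τ}`. [cite: MoonenZarhin1998WeilClasses, §1 Lemma (2) and proof of Criterion (2) («U_E = Z(G_div) ⊂ G_div(X) ↪ Gl_F(V_Y) —det_F→ F^*»; chunk p0003 L14–L16, L72–L80)] -/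
theorem detOnEigenspace_eq_prod_pow_finrank (hRsq : Squarefree R) (hTR : aeval T R = 0)
    {u : complexBetti A.X 1 ≃ₗ[ℂ] complexBetti A.X 1} {c : ℂ → ℂ}
    (hu : ∀ (z : ℂ), ∀ x ∈ T.eigenspace z, u x = c z • x) {F : Module.End ℂ (complexBetti A.X 1)}
    (hc : ∀ x, u (F x) = F (u x)) (hTF : T * F = F * T) (ρ : ℂ) :
    detOnEigenspace u F hc ρ =
      ∏ z ∈ R.roots.toFinset, c z ^ Module.finrank ℂ ↥(F.eigenspace ρ ⊓ T.eigenspace z) := by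
  classical
  haveI : Module.Finite ℂ (complexBetti A.X 1) := abelianVarietyCohomologyExteriorH1_holds.finite_one A
  set W := F.eigenspace ρ with hWdef
  have hTW : ∀ x ∈ W, T x ∈ W := fun x hx ↦ by
    rw [hWdef, Module.End.mem_eigenspace_iff] at hx ⊢
    have e := LinearMap.congr_fun hTF x
    rw [Module.End.mul_apply, Module.End.mul_apply, hx, map_smul] at e
    exact e.symm
  have hTWR : aeval (T.restrict hTW) R = 0 := by
    refine LinearMap.ext fun x ↦ Subtype.ext ?_
    rw [coe_aeval_restrict, hTR, LinearMap.zero_apply, LinearMap.zero_apply, Submodule.coe_zero]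
  obtain ⟨bW, ev, hev, hbW⟩ := exists_eigenbasis_sigma hRsq hTWR
  have hbWV : ∀ j, (bW j : complexBetti A.X 1) ∈ T.eigenspace (ev j) := fun j ↦ by
    have e := congrArg Subtype.val (Module.End.mem_eigenspace_iff.1 (hbW j))
    rw [LinearMap.coe_restrict_apply, Submodule.coe_smul] at e
    exact Module.End.mem_eigenspace_iff.2 e
  -- `u|_W` is diagonal on `bW`
  unfold detOnEigenspace
  have huW : ∀ j, ((u : complexBetti A.X 1 →ₗ[ℂ] complexBetti A.X 1).restrict (mapsTo_eigenspace_of_comm hc ρ)) (bW j) =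
      c (ev j) • bW j := fun j ↦ Subtype.ext (by
    rw [LinearMap.coe_restrict_apply, Submodule.coe_smul]
    exact hu _ _ (hbWV j))
  rw [det_eq_prod_of_basis bW huW]
  have hcount : ∀ z : R.roots.toFinset, Module.finrank ℂ ↥(Module.End.eigenspace (T.restrict hTW) (z : ℂ)) =
      Module.finrank ℂ ↥(W ⊓ T.eigenspace (z : ℂ)) := fun z ↦ by
    rw [← Submodule.finrank_map_subtype_eq W (Module.End.eigenspace (T.restrict hTW) (z : ℂ)),
      map_subtype_eigenspace_restrict]
  simp_rw [hev]
  rw [← Finset.univ_sigma_univ, Finset.prod_sigma]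
  simp_rw [Finset.prod_const, Finset.card_univ, Fintype.card_fin]
  rw [← Finset.prod_coe_sort R.roots.toFinset]
  exact Finset.prod_congr rfl fun z _ ↦ by rw [hcount]

end Torus

end CentralTorus

open CentralTorus

/-! ### §4 Multiplicity imbalance between `ψ` and its Rosati image on `V_ρ` ⟹ all non-zero Weil classes of `F` are
exceptional -/

section Main

variable {A : AbelianVariety ℂ} {h : complexBetti A.X 2} {φ : A ⟶ A} {P : Polynomial ℤ} {e m : ℕ}
  {T T' : Module.End ℂ (complexBetti A.X 1)} {R : ℂ[X]}

/-- **MOONEN–ZARHIN's `θ ≠ 0` AS AN EIGENVALUE COUNT, FOR EVERY COMPLEX ABELIAN VARIETY.** Let `F = ℚ(φ) ⊆ End⁰(A)`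
(`P(φ) = 0`, `P ∈ ℤ[T]` monic irreducible of degree `e`, `e · 2m = 2 dim A`, `m ≠ 0`), `h ∈ B¹(A) ⊗ ℂ` with `Q_h`
non-degenerate, and let `T ∈ C(A) ⊗ ℂ` be a diagonalisable operator on `H¹(A(ℂ); ℂ)` commuting with all of
`End⁰(A) ⊗ ℂ` (the pull-back `ψ^*` of a CENTRAL endomorphism `ψ ∈ E = Z(End⁰ A)`, killed by a square-free `R`) whose
`Q_h`-adjoint `T'` («`ψ†`, the Rosati image») is a polynomial in `T`. If for some complex root `ρ` of `P` and some
`σ ∈ ℂ` THE MULTIPLICITIES OF THE EIGENVALUE `σ` OF `T` AND OF `T'` ON `V_ρ = ker(φ^* - ρ)` DIFFER —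
`dim(V_ρ ∩ ker(T - σ)) ≠ dim(V_ρ ∩ ker(T' - σ))` — then `W_F ⊗ ℂ ⊓ 𝒟ᵐ ⊗ ℂ = ⊥`: ALL NON-ZERO WEIL CLASSES OF `F` ARE
EXCEPTIONAL. Proof: `σ` is spectral for `T` with `σ′ = r(σ) ≠ σ` and `ker(T' - σ) = ker(T - σ′)` (§1); the torus
element `u = 2 ⊕ 2⁻¹ ⊕ 1` on `ker(T - σ) ⊕ ker(T - σ′) ⊕ rest` lies in `S(A)(h)(ℂ)` (§2) and has
`det(u | V_ρ) = 2^{dim(V_ρ ∩ ker(T-σ)) - dim(V_ρ ∩ ker(T-σ′))} ≠ 1` (§3); then the tree's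
`weilClassesField_inf_divisorClassesSpan_eq_bot_iff_exists_detOnEigenspace_ne_one` («all non-zero classes exceptional ⟺
some `u ∈ G_div(X)(ℂ)` has `det(u | V_ρ) ≠ 1`»). This is the print's case «Type 4 with `d ≥ 2` or `m ≥ 2` and `θ : E₋ ↪
End_F(V_X) —Tr_F→ F` non-zero» read through the torus `U_E` rather than through its Lie algebra: for `α = ψ - ψ† ∈ E₋`,
`θ(α)` at the place `ρ` is `Σ_σ (dim(V_ρ ∩ ker(ψ^* - σ)) - dim(V_ρ ∩ ker(ψ†^* - σ))) · σ`, and the displayed imbalance is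
what makes `U_E → F^*`, `a ↦ det_F(a; V_X)`, non-trivial — with no type, simplicity or connectedness hypothesis, and
containing the seat's `…_of_central_skew` (`T' = -T`: `ker(T' - σ) = ker(T + σ)`).
[cite: MoonenZarhin1998WeilClasses, §1 Criterion (2), case «Type 4 with d ≥ 2 or m ≥ 2» and its proof («U_E = Z(G_div) ⊂ G_div(X) ↪ Gl_F(V_Y) —det_F→ F^* … The torus U_E being connected, this is the case if and only if … θ … is zero»; chunk p0003 L46–L60, L72–L80)]
[cite: Milne1999LefschetzClasses, §1 pp. 642–644, Thm. 3.2, Cor. 4.5] -/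
theorem weilClassesField_inf_divisorClassesSpan_eq_bot_of_finrank_inf_eigenspace_ne (hPm : P.Monic) (hPe : P.natDegree = e)
    (hPirr : Irreducible (P.map (Int.castRingHom ℚ)))
    (hφ : Polynomial.eval₂ (Int.castRingHom (CategoryTheory.End A)) (φ : CategoryTheory.End A) P = 0)
    (her : e * (2 * m) = 2 * A.dim) (hm : m ≠ 0) (hh : h ∈ hodgeClassSpan A.dim A.X 1)
    (hnd : ∀ x : complexBetti A.X 1, (∀ y, polarizationPairingOne A.X h (A.dim - 1) x y = 0) → x = 0)
    (hTC : T ∈ centralizerAlgebra A) (hRsq : Squarefree R) (hTR : aeval T R = 0)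
    (hT' : T' ∈ Algebra.adjoin ℂ ({T} : Set (Module.End ℂ (complexBetti A.X 1))))
    (hadj : ∀ x y : complexBetti A.X 1, polarizationPairingOne A.X h (A.dim - 1) (T x) y =
      polarizationPairingOne A.X h (A.dim - 1) x (T' y))
    {ρ σ : ℂ} (hρ : Polynomial.eval₂ (Int.castRingHom ℂ) ρ P = 0)
    (hne : Module.finrank ℂ ↥((pullbackOne A φ).eigenspace ρ ⊓ T.eigenspace σ) ≠
      Module.finrank ℂ ↥((pullbackOne A φ).eigenspace ρ ⊓ T'.eigenspace σ)) :
    weilClassesField A φ P (2 * m) ⊓ divisorClassesSpan A.X A.dim m = ⊥ := by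
  classical
  haveI : Module.Finite ℂ (complexBetti A.X 1) := abelianVarietyCohomologyExteriorH1_holds.finite_one A
  obtain ⟨r, hr⟩ : ∃ r : ℂ[X], T' = aeval T r := by
    rw [Algebra.adjoin_singleton_eq_range_aeval] at hT'
    obtain ⟨r, hr⟩ := hT'
    exact ⟨r, hr.symm⟩
  set F : Module.End ℂ (complexBetti A.X 1) := pullbackOne A φ with hFdef
  have hTF : T * F = F * T := (mem_centralizerAlgebra_iff.1 hTC φ).symm
  -- `σ` is in the spectrum of `T`
  by_cases hσ : T.eigenspace σ = ⊥
  · exfalso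
    rw [hσ, inf_bot_eq, finrank_bot, eigenspace_adjoint_eq_bot hnd hRsq hTR hadj hr hσ, inf_bot_eq, finrank_bot] at hne
    exact hne rfl
  rw [eigenspace_adjoint_eq_eigenspace_eval hnd hRsq hTR hadj hr hσ] at hne
  have hσ' : r.eval σ ≠ σ := fun e ↦ hne (by rw [e])
  -- the torus element `2 ⊕ 2⁻¹ ⊕ 1` and its determinant on `V_ρ`
  obtain ⟨u, hu, huact⟩ := exists_mem_unitaryCentralizerGroup_torus hnd hTC hRsq hTR hadj hr hσ hσ' (t := 2) two_ne_zero
  refine (weilClassesField_inf_divisorClassesSpan_eq_bot_iff_exists_detOnEigenspace_ne_one hPm hPe hPirr hφ her hm hh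
    hnd).2 ⟨u, hu, ρ, hρ, ?_⟩
  rw [detOnEigenspace_eq_prod_pow_finrank hRsq hTR huact (hu.1 φ) hTF ρ]
  -- evaluate the product: only `z = σ` and `z = σ′` contribute
  set d : ℂ → ℕ := fun z ↦ Module.finrank ℂ ↥(F.eigenspace ρ ⊓ T.eigenspace z) with hddef
  have hmem : ∀ {z : ℂ}, T.eigenspace z ≠ ⊥ → z ∈ R.roots.toFinset := fun hz ↦
    Multiset.mem_toFinset.2 ((Polynomial.mem_roots hRsq.ne_zero).2 (isRoot_of_eigenspace_ne_bot hTR hz))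
  have hσZ : σ ∈ R.roots.toFinset := hmem hσ
  have hσ'Z : r.eval σ ∈ R.roots.toFinset \ {σ} :=
    Finset.mem_sdiff.2 ⟨hmem (eigenspace_eval_ne_bot hnd hRsq hTR hadj hr hσ).1, fun e ↦ hσ' (Finset.mem_singleton.1 e)⟩
  rw [Finset.prod_eq_prod_sdiff_singleton_mul hσZ, Finset.prod_eq_prod_sdiff_singleton_mul hσ'Z,
    Finset.prod_eq_one (fun z hz ↦ ?_)]
  · simp only [if_true, if_neg hσ', one_mul]
    change (2 : ℂ)⁻¹ ^ d (r.eval σ) * 2 ^ d σ ≠ 1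
    intro habs
    have h2 : (2 : ℂ) ^ d σ = 2 ^ d (r.eval σ) := by
      have e1 : (2 : ℂ) ^ d (r.eval σ) * ((2 : ℂ)⁻¹ ^ d (r.eval σ) * 2 ^ d σ) = 2 ^ d (r.eval σ) := by
        rw [habs, mul_one]
      rwa [← mul_assoc, ← mul_pow, mul_inv_cancel₀ (two_ne_zero : (2 : ℂ) ≠ 0), one_pow, one_mul] at e1
    have h3 : d σ = d (r.eval σ) := by
      have e2 : ((2 ^ d σ : ℕ) : ℂ) = ((2 ^ d (r.eval σ) : ℕ) : ℂ) := by push_cast; exact h2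
      exact Nat.pow_right_injective le_rfl (Nat.cast_injective e2)
    exact hne h3
  · obtain ⟨hz1, hz2⟩ := Finset.mem_sdiff.1 hz
    obtain ⟨-, hz3⟩ := Finset.mem_sdiff.1 hz1
    rw [Finset.mem_singleton] at hz2 hz3
    rw [if_neg hz3, if_neg hz2, one_pow]

/-! ### §4′ The same with Criterion (1), and the set form -/

/-- **No non-zero Weil class of `F` is a complex combination of products of divisor classes** under the hypotheses of
`weilClassesField_inf_divisorClassesSpan_eq_bot_of_finrank_inf_eigenspace_ne` (set form).
[cite: MoonenZarhin1998WeilClasses, §1 Criterion (2), case «Type 4 with d ≥ 2 or m ≥ 2» and its proof (chunk p0003 L46–L80)] -/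
theorem not_mem_divisorClassesSpan_of_finrank_inf_eigenspace_ne (hPm : P.Monic) (hPe : P.natDegree = e)
    (hPirr : Irreducible (P.map (Int.castRingHom ℚ)))
    (hφ : Polynomial.eval₂ (Int.castRingHom (CategoryTheory.End A)) (φ : CategoryTheory.End A) P = 0)
    (her : e * (2 * m) = 2 * A.dim) (hm : m ≠ 0) (hh : h ∈ hodgeClassSpan A.dim A.X 1)
    (hnd : ∀ x : complexBetti A.X 1, (∀ y, polarizationPairingOne A.X h (A.dim - 1) x y = 0) → x = 0)
    (hTC : T ∈ centralizerAlgebra A) (hRsq : Squarefree R) (hTR : aeval T R = 0)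
    (hT' : T' ∈ Algebra.adjoin ℂ ({T} : Set (Module.End ℂ (complexBetti A.X 1))))
    (hadj : ∀ x y : complexBetti A.X 1, polarizationPairingOne A.X h (A.dim - 1) (T x) y =
      polarizationPairingOne A.X h (A.dim - 1) x (T' y))
    {ρ σ : ℂ} (hρ : Polynomial.eval₂ (Int.castRingHom ℂ) ρ P = 0)
    (hne : Module.finrank ℂ ↥((pullbackOne A φ).eigenspace ρ ⊓ T.eigenspace σ) ≠
      Module.finrank ℂ ↥((pullbackOne A φ).eigenspace ρ ⊓ T'.eigenspace σ))
    {c : complexBetti A.X (2 * m)} (hcW : c ∈ weilClassesField A φ P (2 * m)) (hc0 : c ≠ 0) :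
    c ∉ divisorClassesSpan A.X A.dim m := by
  intro hcD
  have hc : c ∈ weilClassesField A φ P (2 * m) ⊓ divisorClassesSpan A.X A.dim m := ⟨hcW, hcD⟩
  rw [weilClassesField_inf_divisorClassesSpan_eq_bot_of_finrank_inf_eigenspace_ne hPm hPe hPirr hφ her hm hh hnd hTC hRsq
    hTR hT' hadj hρ hne, Submodule.mem_bot] at hc
  exact hc0 hc

/-- **«Hodge but exceptional»**: if moreover the multiplicities of `F` on `H^{1,0}` are balanced (`n_ρ = n_ρ̄` at every
complex root: Criterion (1), the tree's `Deligne1982.weilClassesField_le_hodgeClassSpan_iff_forall_eigenMultiplicity_eq`),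
then `W_F` consists of HODGE classes all of whose non-zero members are exceptional: `W_F ⊗ ℂ ≤ Bᵐ ⊗ ℂ` and
`W_F ⊗ ℂ ⊓ 𝒟ᵐ ⊗ ℂ = ⊥`. [cite: MoonenZarhin1998WeilClasses, §1 Criterion (1) and Criterion (2), case «Type 4 with d ≥ 2 or m ≥ 2» (chunks p0001–p0003)]
[cite: vanGeemen1994HodgeAV, 6.12] -/
theorem weilClassesField_le_hodgeClassSpan_and_inf_eq_bot_of_finrank_inf_eigenspace_ne (hPm : P.Monic)
    (hPe : P.natDegree = e) (hPirr : Irreducible (P.map (Int.castRingHom ℚ)))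
    (hφ : Polynomial.eval₂ (Int.castRingHom (CategoryTheory.End A)) (φ : CategoryTheory.End A) P = 0)
    (her : e * (2 * m) = 2 * A.dim) (hm : m ≠ 0) (hh : h ∈ hodgeClassSpan A.dim A.X 1)
    (hnd : ∀ x : complexBetti A.X 1, (∀ y, polarizationPairingOne A.X h (A.dim - 1) x y = 0) → x = 0)
    (hTC : T ∈ centralizerAlgebra A) (hRsq : Squarefree R) (hTR : aeval T R = 0)
    (hT' : T' ∈ Algebra.adjoin ℂ ({T} : Set (Module.End ℂ (complexBetti A.X 1))))
    (hadj : ∀ x y : complexBetti A.X 1, polarizationPairingOne A.X h (A.dim - 1) (T x) y =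
      polarizationPairingOne A.X h (A.dim - 1) x (T' y))
    {ρ σ : ℂ} (hρ : Polynomial.eval₂ (Int.castRingHom ℂ) ρ P = 0)
    (hne : Module.finrank ℂ ↥((pullbackOne A φ).eigenspace ρ ⊓ T.eigenspace σ) ≠
      Module.finrank ℂ ↥((pullbackOne A φ).eigenspace ρ ⊓ T'.eigenspace σ))
    (hbal : ∀ ρ : ℂ, Polynomial.eval₂ (Int.castRingHom ℂ) ρ P = 0 →
      eigenMultiplicity A φ ρ = eigenMultiplicity A φ (starRingEnd ℂ ρ)) :
    weilClassesField A φ P (2 * m) ≤ hodgeClassSpan A.dim A.X m ∧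
      weilClassesField A φ P (2 * m) ⊓ divisorClassesSpan A.X A.dim m = ⊥ :=
  ⟨(Deligne1982.weilClassesField_le_hodgeClassSpan_iff_forall_eigenMultiplicity_eq hPm hPe hPirr hφ her).2 hbal,
    weilClassesField_inf_divisorClassesSpan_eq_bot_of_finrank_inf_eigenspace_ne hPm hPe hPirr hφ her hm hh hnd hTC hRsq hTR
      hT' hadj hρ hne⟩

end Main

/-! ### §5 From `End(A)`: a central endomorphism `ψ` with minimal polynomial `R` and Rosati image in `ℚ(ψ)` -/

section EndLevel

variable {A : AbelianVariety ℂ} {h : complexBetti A.X 2} {φ ψ ψ' : A ⟶ A} {P R : Polynomial ℤ} {e m : ℕ}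

/-- A polynomial `R ∈ ℤ[T]` irreducible over `ℚ` is square-free over `ℂ` (separable in characteristic `0`). [folklore] -/
private theorem squarefree_map_complex_of_irreducible (hRirr : Irreducible (R.map (Int.castRingHom ℚ))) :
    Squarefree (R.map (Int.castRingHom ℂ)) := by
  rw [map_castRingHom_complex_eq]
  exact hRirr.separable.map.squarefree

/-- **THE `End(A)`-LEVEL STATEMENT.** Let `ψ ∈ End(A)` be CENTRAL on `H¹` (`ψ^* ∈ C(A) ⊗ ℂ`, e.g. `ψ ∈ Z(End A)`) with
`R(ψ) = 0`, `R ∈ ℤ[T]` irreducible over `ℚ` (`E ⊇ ℚ(ψ)`), and let `ψ' ∈ End(A)` be its ROSATI IMAGE for the polarization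
class `h` (`Q_h(ψ^* x, y) = Q_h(x, ψ'^* y)`) with `ψ'^* ∈ ℂ[ψ^*]` (`ψ† ∈ ℚ(ψ)`: automatic when `ℚ(ψ)` is a `†`-stable
subfield of the centre, e.g. the CM centre `E` of a type-4 algebra, on which `†` is complex conjugation). If the
multiplicities of an eigenvalue `σ` of `ψ^*` and of `ψ'^*` on some eigenspace `V_ρ` of `F = ℚ(φ)` differ, then all
non-zero Weil classes of `F` are exceptional: `W_F ⊗ ℂ ⊓ 𝒟ᵐ ⊗ ℂ = ⊥` (`m ≠ 0`; `h ∈ B¹ ⊗ ℂ`, `Q_h` non-degenerate).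
[cite: MoonenZarhin1998WeilClasses, §1 Criterion (2), case «Type 4 with d ≥ 2 or m ≥ 2» and its proof (chunk p0003 L46–L80); Remark (2) after it (chunk p0004 L48–L53)]
[cite: Milne1999LefschetzClasses, §1 pp. 642–644] -/
theorem weilClassesField_inf_divisorClassesSpan_eq_bot_of_central_of_finrank_ne (hPm : P.Monic) (hPe : P.natDegree = e)
    (hPirr : Irreducible (P.map (Int.castRingHom ℚ)))
    (hφ : Polynomial.eval₂ (Int.castRingHom (CategoryTheory.End A)) (φ : CategoryTheory.End A) P = 0)
    (her : e * (2 * m) = 2 * A.dim) (hm : m ≠ 0) (hh : h ∈ hodgeClassSpan A.dim A.X 1)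
    (hnd : ∀ x : complexBetti A.X 1, (∀ y, polarizationPairingOne A.X h (A.dim - 1) x y = 0) → x = 0)
    (hψC : pullbackOne A ψ ∈ centralizerAlgebra A) (hRirr : Irreducible (R.map (Int.castRingHom ℚ)))
    (hψR : Polynomial.eval₂ (Int.castRingHom (CategoryTheory.End A)) (ψ : CategoryTheory.End A) R = 0)
    (hψ' : pullbackOne A ψ' ∈ Algebra.adjoin ℂ ({pullbackOne A ψ} : Set (Module.End ℂ (complexBetti A.X 1))))
    (hadj : ∀ x y : complexBetti A.X 1, polarizationPairingOne A.X h (A.dim - 1) (pullbackOne A ψ x) y =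
      polarizationPairingOne A.X h (A.dim - 1) x (pullbackOne A ψ' y))
    {ρ σ : ℂ} (hρ : Polynomial.eval₂ (Int.castRingHom ℂ) ρ P = 0)
    (hne : Module.finrank ℂ ↥((pullbackOne A φ).eigenspace ρ ⊓ (pullbackOne A ψ).eigenspace σ) ≠
      Module.finrank ℂ ↥((pullbackOne A φ).eigenspace ρ ⊓ (pullbackOne A ψ').eigenspace σ)) :
    weilClassesField A φ P (2 * m) ⊓ divisorClassesSpan A.X A.dim m = ⊥ :=
  weilClassesField_inf_divisorClassesSpan_eq_bot_of_finrank_inf_eigenspace_ne hPm hPe hPirr hφ her hm hh hnd hψC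
    (squarefree_map_complex_of_irreducible hRirr) (aeval_hom_complexBetti_map_one_eq_zero hψR) hψ' hadj hρ hne

/-- **… with Criterion (1): `W_F` consists of exceptional HODGE classes** when moreover `n_ρ = n_ρ̄` at every root.
[cite: MoonenZarhin1998WeilClasses, §1 Criterion (1)–(2) (chunks p0001–p0003)] [cite: vanGeemen1994HodgeAV, 6.12] -/
theorem weilClassesField_le_hodgeClassSpan_and_inf_eq_bot_of_central_of_finrank_ne (hPm : P.Monic)
    (hPe : P.natDegree = e) (hPirr : Irreducible (P.map (Int.castRingHom ℚ)))
    (hφ : Polynomial.eval₂ (Int.castRingHom (CategoryTheory.End A)) (φ : CategoryTheory.End A) P = 0)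
    (her : e * (2 * m) = 2 * A.dim) (hm : m ≠ 0) (hh : h ∈ hodgeClassSpan A.dim A.X 1)
    (hnd : ∀ x : complexBetti A.X 1, (∀ y, polarizationPairingOne A.X h (A.dim - 1) x y = 0) → x = 0)
    (hψC : pullbackOne A ψ ∈ centralizerAlgebra A) (hRirr : Irreducible (R.map (Int.castRingHom ℚ)))
    (hψR : Polynomial.eval₂ (Int.castRingHom (CategoryTheory.End A)) (ψ : CategoryTheory.End A) R = 0)
    (hψ' : pullbackOne A ψ' ∈ Algebra.adjoin ℂ ({pullbackOne A ψ} : Set (Module.End ℂ (complexBetti A.X 1))))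
    (hadj : ∀ x y : complexBetti A.X 1, polarizationPairingOne A.X h (A.dim - 1) (pullbackOne A ψ x) y =
      polarizationPairingOne A.X h (A.dim - 1) x (pullbackOne A ψ' y))
    {ρ σ : ℂ} (hρ : Polynomial.eval₂ (Int.castRingHom ℂ) ρ P = 0)
    (hne : Module.finrank ℂ ↥((pullbackOne A φ).eigenspace ρ ⊓ (pullbackOne A ψ).eigenspace σ) ≠
      Module.finrank ℂ ↥((pullbackOne A φ).eigenspace ρ ⊓ (pullbackOne A ψ').eigenspace σ))
    (hbal : ∀ ρ : ℂ, Polynomial.eval₂ (Int.castRingHom ℂ) ρ P = 0 →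
      eigenMultiplicity A φ ρ = eigenMultiplicity A φ (starRingEnd ℂ ρ)) :
    weilClassesField A φ P (2 * m) ≤ hodgeClassSpan A.dim A.X m ∧
      weilClassesField A φ P (2 * m) ⊓ divisorClassesSpan A.X A.dim m = ⊥ :=
  weilClassesField_le_hodgeClassSpan_and_inf_eq_bot_of_finrank_inf_eigenspace_ne hPm hPe hPirr hφ her hm hh hnd hψC
    (squarefree_map_complex_of_irreducible hRirr) (aeval_hom_complexBetti_map_one_eq_zero hψR) hψ' hadj hρ hne hbal

end EndLevel

/-! ### §6 Powers `X = A^{n+1}` with the product polarization: the diagonal `ψ ⊕ ⋯ ⊕ ψ` of a central `ψ` -/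

section Powers

variable {A : AbelianVariety ℂ} {h : complexBetti A.X 2} {n : ℕ} {ψ ψ' : A ⟶ A}
  {φ : ⨁ (fun _ : Fin (n + 1) => A) ⟶ ⨁ (fun _ : Fin (n + 1) => A)} {P R : Polynomial ℤ} {e m : ℕ}

/-- **A central endomorphism acts diagonally as a central endomorphism of the power**: if `ψ ≫ χ = χ ≫ ψ` for every
`χ ∈ End(A)`, then `(⊕ψ) ≫ Χ = Χ ≫ (⊕ψ)` for every `Χ ∈ End(A^{n+1}) = M_{n+1}(End A)` (entry by entry).
[cite: Milne1999LefschetzClasses, §1 p. 643 («the diagonal action of C(A) on rV(A) identifies C(A) with C(A^r)»)] [cite: LangeBirkenhake1992, §1.1] -/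
theorem biproductMap_const_comm_of_forall_comm (hψ : ∀ χ : A ⟶ A, ψ ≫ χ = χ ≫ ψ)
    (Χ : ⨁ (fun _ : Fin (n + 1) => A) ⟶ ⨁ (fun _ : Fin (n + 1) => A)) :
    (biproduct.map fun _ : Fin (n + 1) => ψ) ≫ Χ = Χ ≫ biproduct.map fun _ : Fin (n + 1) => ψ := by
  refine biproduct.hom_ext _ _ fun b ↦ biproduct.hom_ext' _ _ fun a ↦ ?_
  simp only [Category.assoc, biproduct.map_π, biproduct.ι_map_assoc]
  rw [hψ (biproduct.ι (fun _ : Fin (n + 1) => A) a ≫ Χ ≫ biproduct.π (fun _ : Fin (n + 1) => A) b)]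
  simp only [Category.assoc]

/-- **`(⊕ψ)^* ∈ C(A^{n+1}) ⊗ ℂ`** for `ψ` commuting with all of `End(A)`. [cite: Milne1999LefschetzClasses, §1 p. 643] -/
theorem pullbackOne_biproductMap_const_mem_centralizerAlgebra (hψ : ∀ χ : A ⟶ A, ψ ≫ χ = χ ≫ ψ) :
    pullbackOne (⨁ (fun _ : Fin (n + 1) => A)) (biproduct.map fun _ : Fin (n + 1) => ψ) ∈
      centralizerAlgebra (⨁ (fun _ : Fin (n + 1) => A)) := by
  rw [mem_centralizerAlgebra_iff]
  intro Χ
  rw [← pullbackOne_comp_eq_mul, ← pullbackOne_comp_eq_mul, biproductMap_const_comm_of_forall_comm hψ]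

/-- `ψ'^* ∈ ℂ[ψ^*]` on `H¹(A)` ⟹ `(⊕ψ')^* ∈ ℂ[(⊕ψ)^*]` on `H¹(A^{n+1})`. [cite: LangeBirkenhake1992, §1.1] -/
theorem pullbackOne_biproductMap_const_mem_adjoin_of_mem_adjoin
    (hψ' : pullbackOne A ψ' ∈ Algebra.adjoin ℂ ({pullbackOne A ψ} : Set (Module.End ℂ (complexBetti A.X 1)))) :
    pullbackOne (⨁ (fun _ : Fin (n + 1) => A)) (biproduct.map fun _ : Fin (n + 1) => ψ') ∈ Algebra.adjoin ℂ
      ({pullbackOne (⨁ (fun _ : Fin (n + 1) => A)) (biproduct.map fun _ : Fin (n + 1) => ψ)} :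
        Set (Module.End ℂ (complexBetti (⨁ (fun _ : Fin (n + 1) => A)).X 1))) := by
  rw [Algebra.adjoin_singleton_eq_range_aeval] at hψ'
  obtain ⟨q, hq⟩ := hψ'
  rw [pullbackOne_biproductMap_const_eq_aeval_of_eq_aeval hq.symm]
  exact Polynomial.aeval_mem_adjoin_singleton ℂ _

/-- `R(ψ) = 0` in `End(A)` ⟹ `R((⊕ψ)^*) = 0` on `H¹(A^{n+1})`. [cite: LangeBirkenhake1992, §1.1] -/
theorem aeval_pullbackOne_biproductMap_const_eq_zero
    (hψR : Polynomial.eval₂ (Int.castRingHom (CategoryTheory.End A)) (ψ : CategoryTheory.End A) R = 0) :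
    aeval (pullbackOne (⨁ (fun _ : Fin (n + 1) => A)) (biproduct.map fun _ : Fin (n + 1) => ψ))
      (R.map (Int.castRingHom ℂ)) = 0 := by
  have h0 : pullbackOne A (0 : A ⟶ A) = aeval (pullbackOne A ψ) (R.map (Int.castRingHom ℂ)) := by
    rw [pullbackOne_zero_eq_zero, aeval_hom_complexBetti_map_one_eq_zero hψR]
  rw [← pullbackOne_biproductMap_const_eq_aeval_of_eq_aeval h0]
  have hz : (biproduct.map fun _ : Fin (n + 1) => (0 : A ⟶ A)) = 0 :=
    biproduct.hom_ext _ _ fun j ↦ by rw [biproduct.map_π, Limits.comp_zero, Limits.zero_comp]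
  rw [hz, pullbackOne_zero_eq_zero]

/-- **THE POWER CASE — «`X` isogenous to `Y^m`, `Y` of type 4 (`E` a CM field in the centre), `m ≥ 2`»: on `X = A^{n+1}`
with the product polarization `D = Σ πᵢ^* h`, a CENTRAL `ψ ∈ End(A)` (`ψχ = χψ` for all `χ ∈ End(A)`) with `R(ψ) = 0`
(`R` irreducible over `ℚ`) and Rosati image `ψ' ∈ End(A)` (`Q_h(ψ^* x, y) = Q_h(x, ψ'^* y)`, `ψ'^* ∈ ℂ[ψ^*]`) acts
diagonally; if for a subfield `F = ℚ(φ) ⊆ End⁰(X)` (`P(φ) = 0`, `deg P · 2m = 2(n+1) dim A`, `m ≠ 0`) the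
multiplicities of an eigenvalue `σ` of `(⊕ψ)^*` and `(⊕ψ')^*` on some `V_ρ = ker(φ^* - ρ)` differ, then
`W_F(X) ⊗ ℂ ⊓ 𝒟ᵐ(X) ⊗ ℂ = ⊥`.** (For `A` of positive dimension with `h ∈ B¹ ⊗ ℂ`, `h^{dim A} ≠ 0`, `Q_h`
non-degenerate.) [cite: MoonenZarhin1998WeilClasses, §1 Criterion (2), case «Type 4 with d ≥ 2 or m ≥ 2», its proof and Remark (2) (chunks p0003 L46–L80, p0004 L48–L53)]
[cite: Milne1999LefschetzClasses, §1 p. 643] -/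
theorem weilClassesField_biproduct_inf_divisorClassesSpan_eq_bot_of_central_of_finrank_ne (hA : 0 < A.dim)
    (hh : h ∈ hodgeClassSpan A.dim A.X 1) (htop : lefschetzPow h (A.dim - 1) 2 h ≠ 0)
    (hnd : ∀ x : complexBetti A.X 1, (∀ y, polarizationPairingOne A.X h (A.dim - 1) x y = 0) → x = 0)
    (hψ : ∀ χ : A ⟶ A, ψ ≫ χ = χ ≫ ψ) (hRirr : Irreducible (R.map (Int.castRingHom ℚ)))
    (hψR : Polynomial.eval₂ (Int.castRingHom (CategoryTheory.End A)) (ψ : CategoryTheory.End A) R = 0)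
    (hψ' : pullbackOne A ψ' ∈ Algebra.adjoin ℂ ({pullbackOne A ψ} : Set (Module.End ℂ (complexBetti A.X 1))))
    (hadj : ∀ x y : complexBetti A.X 1, polarizationPairingOne A.X h (A.dim - 1) (pullbackOne A ψ x) y =
      polarizationPairingOne A.X h (A.dim - 1) x (pullbackOne A ψ' y))
    (hPm : P.Monic) (hPe : P.natDegree = e) (hPirr : Irreducible (P.map (Int.castRingHom ℚ)))
    (hφ : Polynomial.eval₂ (Int.castRingHom (CategoryTheory.End (⨁ (fun _ : Fin (n + 1) => A))))
      (φ : CategoryTheory.End (⨁ (fun _ : Fin (n + 1) => A))) P = 0)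
    (her : e * (2 * m) = 2 * ((n + 1) * A.dim)) (hm : m ≠ 0)
    {ρ σ : ℂ} (hρ : Polynomial.eval₂ (Int.castRingHom ℂ) ρ P = 0)
    (hne : Module.finrank ℂ ↥((pullbackOne (⨁ (fun _ : Fin (n + 1) => A)) φ).eigenspace ρ ⊓
        (pullbackOne (⨁ (fun _ : Fin (n + 1) => A)) (biproduct.map fun _ : Fin (n + 1) => ψ)).eigenspace σ) ≠
      Module.finrank ℂ ↥((pullbackOne (⨁ (fun _ : Fin (n + 1) => A)) φ).eigenspace ρ ⊓
        (pullbackOne (⨁ (fun _ : Fin (n + 1) => A)) (biproduct.map fun _ : Fin (n + 1) => ψ')).eigenspace σ)) :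
    weilClassesField (⨁ (fun _ : Fin (n + 1) => A)) φ P (2 * m) ⊓
      divisorClassesSpan (⨁ (fun _ : Fin (n + 1) => A)).X (⨁ (fun _ : Fin (n + 1) => A)).dim m = ⊥ := by
  obtain ⟨hhX, -, hndX⟩ := sumPolarizationClass_hypotheses (fun _ : Fin (n + 1) => A) (fun _ => h)
      (fun _ => hA) (fun _ => hh) (fun _ => htop) (fun _ => hnd)
  have herX : e * (2 * m) = 2 * (⨁ (fun _ : Fin (n + 1) => A)).dim := by rw [dim_biproduct_const_succ A n, her]
  exact weilClassesField_inf_divisorClassesSpan_eq_bot_of_finrank_inf_eigenspace_ne hPm hPe hPirr hφ herX hm hhX hndX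
    (pullbackOne_biproductMap_const_mem_centralizerAlgebra hψ) (squarefree_map_complex_of_irreducible hRirr)
    (aeval_pullbackOne_biproductMap_const_eq_zero hψR) (pullbackOne_biproductMap_const_mem_adjoin_of_mem_adjoin hψ')
    (fun x y ↦ polarizationPairingOne_biproductMap_of_adjoint (fun _ : Fin (n + 1) => A) (fun _ => h) (fun _ => hA)
      (fun _ => ψ) (fun _ => ψ') (fun _ => hadj) x y) hρ hne

end Powers

end Literature.AlgebraicGeometry.HodgeTheory

end
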